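import Summits.NavierStokesRegularity.FluidComputer.FluxPassOnFloor
import Summits.NavierStokesRegularity.FluidComputer.SaturationHorizon
import HarnessLib

/-!
# Fluid computer — the CASCADE NECESSITIES of a realised blow-up, assembled (relay + flux face), and the pass-on ledger

HONEST FRAMING (cell `pub-fluidc`, verbatim): *low prior, high value-of-information experiment on Tao's
machine paradigm; NOT a claim that NS blows up.* Theorem side of the cell; nothing here is evidence of blow-up, and
nothing is said about any fixed finite set of levels except where marked FIXED-BAND.

One statement for the cell's paper (OUTLINE §4) collecting, for EVERY maximal smooth finite-energy solution `(u, p)` of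
the unforced Navier–Stokes system on `ℝ³ × [0, T)` (`ν > 0`, Leray–Hopf from `u 0`, no smooth extension past `T`), what
the level dictionary proves a cascade MUST do — the words 'hand the step on upward and forward without end' and 'forward,
not uniformly leaky' as theorems — together with the two-line LEDGER a DNS reader needs to compute the pass-on fraction:

* `influx_eq_passOn_add_keep` (FIXED-BAND identity) — with `Φ(q, N, t₁) = ∫_{t₀}^{t₁} Π_{q..q+N−1}(u) dτ`:
  `Φ(q, N+1, t₁) = Φ(q+1, N, t₁) + keep_q`, `keep_q = −∫_{t₀}^{t₁} N_q(u)` — what crosses the scale `2^q` into `{q,…,q+N}`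
  is what crosses `2^{q+1}` plus what level `q` keeps; the windowed pass-on fraction is `η_flux(q) = Φ(q+1,N,t₁)/Φ(q,N+1,t₁)`.
* `passOn_le_influx_add_stock` (FIXED-BAND) — `Φ(q+1, N, t₁) ≤ Φ(q, N+1, t₁) + ½‖Δ̇_q u(t₀)‖₂²`: a level cannot pass on more
  than it receives plus the stock it held (`keep_q ≥ −½‖Δ̇_q u(t₀)‖₂²`, the backscatter floor of one level) — the CEILING
  `η_flux ≤ 1 + stock/influx` matching the FLOOR `η_flux > η̄` (`η̄ < 2^{-3/2}`) infinitely often of `FluxPassOnFloor`.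
* `cascade_necessities` (**THE ASSEMBLED STATEMENT**) — there are absolute `c, κ > 0` such that for every such solution:
  (R) RELAY: for every threshold `0 < b < c` there is a chain of saturated levels `q₀ < q₁ < ⋯ → ∞` at times
  `t₀' < t₁' < ⋯ → T` (`‖Δ̇_{q_n} u(t_n')‖_∞ ≥ b ν 2^{q_n}`; `SaturationHorizon.exists_saturation_chain_tendsto`);
  and for every interior time `t₀ ∈ (0, T)`:
  (C) CEILING: every finite band flux over every window `[t₀, t₁] ⊂ (0,T)` is `≤ 8‖u(0)‖₂²` (`BandFluxCeiling.band_flux_le`);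
  (F) FORWARD FLOOR: at infinitely many levels `q` some band `{q,…,q+N−1}` and `t₁ ∈ (t₀,T)` have
  `κν³ ≤ ‖u(0)‖₂ 2^{3q/2} Φ(q,N,t₁)` (`ForwardFluxFloor.forward_flux_floor`);
  (P) PASS-ON: for every `η̄ ≥ 0` with `2√2·η̄ < 1`, at infinitely many `q` some `N, t₁` have `η̄·Φ(q,N+1,t₁) < Φ(q+1,N,t₁)`
  (`FluxPassOnFloor.pass_on_floor`).
  HONEST SIZE NOTE: (F) and (P) are asymptotic in the level and carry `(ν/‖u₀‖₂)³` against (C) — `≈ 3·10⁻⁷` on the cell's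
  `ρ = 3` rows: they are read against words, not against certified level-one/two numbers. Necessity only; no sufficiency.

0 sorry; no new definitions, no named facts.

## References

* A. Cheskidov, R. Shvydkoy, Arch. Ration. Mech. Anal. 195 (2010) 159–169, Lemma 3.2. [CheskidovShvydkoy2010]
* T. Tao, J. Amer. Math. Soc. 29 (2016) 601–674. [Tao2016AveragedNS]
-/

noncomputable section

open MeasureTheory Set Function Filter Topology
open scoped ENNReal NNReal RealInnerProductSpace
open Literature.Analysis.FluidPDE Literature.Analysis.FunctionSpaces
open Summit.NavierStokesRegularity.FluidComputer.BlockEnergyIdentity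
open Summit.NavierStokesRegularity.FluidComputer.BandFluxCeiling

namespace Summit.NavierStokesRegularity.FluidComputer.CascadeNecessities

/-! ## The pass-on ledger (fixed band) -/

/-- **INFLUX = PASS-ON + KEEP (fixed-band identity).** For every field history `u`, all `t₀, t₁` and all `q, N`: the windowed
flux into `{q,…,q+N}` equals the windowed flux into `{q+1,…,q+N}` plus what level `q` keeps, `−∫_{t₀}^{t₁} N_q(u)` — the
splitting `∑_{k<N+1} f(q+k) = ∑_{k<N} f(q+1+k) + f(q)`. The DNS reader's pass-on fraction is the ratio of the first two
terms. [folklore] -/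
theorem influx_eq_passOn_add_keep (u : ℝ → EuclideanSpace ℝ (Fin 3) → EuclideanSpace ℝ (Fin 3)) (t₀ t₁ : ℝ)
    (q N : ℕ) :
    -∑ k ∈ Finset.range (N + 1), (∫ τ in t₀..t₁,
        ∫ x, ⟪blockFn ((q + k : ℕ) : ℤ) (u τ) x, blockFn ((q + k : ℕ) : ℤ) (convect (u τ) (u τ)) x⟫) =
      -∑ k ∈ Finset.range N, (∫ τ in t₀..t₁,
        ∫ x, ⟪blockFn ((q + 1 + k : ℕ) : ℤ) (u τ) x, blockFn ((q + 1 + k : ℕ) : ℤ) (convect (u τ) (u τ)) x⟫) +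
      -(∫ τ in t₀..t₁, ∫ x, ⟪blockFn ((q : ℕ) : ℤ) (u τ) x, blockFn ((q : ℕ) : ℤ) (convect (u τ) (u τ)) x⟫) := by
  rw [Finset.sum_range_succ', neg_add]
  congr 1
  · congr 1
    refine Finset.sum_congr rfl fun k _ => ?_
    rw [show q + (k + 1) = q + 1 + k by omega]

/-- **A LEVEL CANNOT PASS ON MORE THAN IT RECEIVES PLUS ITS STOCK (fixed band).** Along every maximal smooth solution
Leray–Hopf from `u 0` (`ν > 0`), for `0 < t₀ ≤ t₁ < T` and all `q, N`:
`Φ(q+1, N, t₁) ≤ Φ(q, N+1, t₁) + ½‖Δ̇_q u(t₀)‖₂²` — the backscatter floor of the single level `q`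
(`keep_q = ½(‖Δ̇_q u(t₁)‖₂² − ‖Δ̇_q u(t₀)‖₂²) + ν∫S_q ≥ −½‖Δ̇_q u(t₀)‖₂²`). With `FluxPassOnFloor.pass_on_floor` this brackets the
windowed pass-on fraction: `η̄ < η_flux(q) ≤ 1 + ‖Δ̇_q u(t₀)‖₂²/(2Φ(q,N+1,t₁))` infinitely often, the stock of a high level at
an interior time being `≤ 4^{-q} F(u(t₀))`. [cite: CheskidovShvydkoy2010, Lemma 3.2 (proof, (8))] -/
theorem passOn_le_influx_add_stock {ν T : ℝ} (hν : 0 < ν) (hT : 0 < T)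
    {u : ℝ → EuclideanSpace ℝ (Fin 3) → EuclideanSpace ℝ (Fin 3)} {p : ℝ → EuclideanSpace ℝ (Fin 3) → ℝ}
    (hmax : IsMaximalSmoothSolution ν 0 u p T) (hLH : IsLerayHopfOn T ν 0 (u 0) u)
    {t₀ t₁ : ℝ} (ht₀ : 0 < t₀) (h01 : t₀ ≤ t₁) (ht₁ : t₁ < T) (q N : ℕ) :
    -∑ k ∈ Finset.range N, (∫ τ in t₀..t₁,
        ∫ x, ⟪blockFn ((q + 1 + k : ℕ) : ℤ) (u τ) x, blockFn ((q + 1 + k : ℕ) : ℤ) (convect (u τ) (u τ)) x⟫) ≤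
      -∑ k ∈ Finset.range (N + 1), (∫ τ in t₀..t₁,
        ∫ x, ⟪blockFn ((q + k : ℕ) : ℤ) (u τ) x, blockFn ((q + k : ℕ) : ℤ) (convect (u τ) (u τ)) x⟫) +
      (blockL2 (u t₀) ((q : ℕ) : ℤ) ^ 2).toReal / 2 := by
  rw [influx_eq_passOn_add_keep u t₀ t₁ q N]
  obtain ⟨h1, -⟩ := neg_integral_transfer_ge hν hT hmax hLH ht₀ h01 ht₁ ((q : ℕ) : ℤ)
  have hS0 : 0 ≤ ∫ τ in t₀..t₁, (∑ i, ∫ x, ‖fderiv ℝ (blockFn ((q : ℕ) : ℤ) (u τ)) x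
      (stdOrthonormalBasis ℝ (EuclideanSpace ℝ (Fin 3)) i)‖ ^ 2) :=
    intervalIntegral.integral_nonneg h01 fun τ _ =>
      Finset.sum_nonneg fun i _ => integral_nonneg fun x => by positivity
  nlinarith [mul_nonneg hν.le hS0]

/-! ## The assembled statement -/

/-- **THE CASCADE NECESSITIES OF A REALISED BLOW-UP (relay + flux face, assembled).** There are absolute constants
`c > 0` (Cheskidov–Shvydkoy's saturation threshold scale) and `κ > 0` (the forward-flux constant) such that for every
`ν > 0`, `T > 0` and every maximal smooth solution `(u, p)` of the unforced Navier–Stokes system on `ℝ³ × [0, T)` which is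
Leray–Hopf from `u 0`:
(R) RELAY — for every `0 < b < c` there are levels `q₀ < q₁ < ⋯ → ∞` and times `0 < t₀' < t₁' < ⋯ → T` with level `q_n`
saturated at time `t_n'` (`b ν 2^{q_n} ≤ ‖Δ̇_{q_n} u(t_n')‖_∞`): the step is handed on UPWARD AND FORWARD WITHOUT END, converging
on the blow-up time; and for every interior time `t₀ ∈ (0, T)`:
(C) CEILING — for all `t₁ ∈ [t₀, T)` and every finite band `B`, `∫_{t₀}^{t₁} Π_B(u) dτ ≤ 8‖u(0)‖₂²`;
(F) FORWARD FLOOR — at infinitely many levels `q` some `N`, `t₁ ∈ (t₀, T)` have `κν³ ≤ ‖u(0)‖₂ · 2^q√(2^q) · Φ(q, N, t₁)`;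
(P) PASS-ON — for every `η̄ ≥ 0` with `2√2 · η̄ < 1`, at infinitely many `q` some `N`, `t₁ ∈ (t₀, T)` have
`η̄ · Φ(q, N+1, t₁) < Φ(q+1, N, t₁)`.
Assembly of `SaturationHorizon.exists_saturation_chain_tendsto`, `BandFluxCeiling.band_flux_le`,
`ForwardFluxFloor.forward_flux_floor`, `FluxPassOnFloor.pass_on_floor`. HONEST SIZE NOTE: (F)/(P) are asymptotic in the
level and carry `(ν/‖u₀‖₂)³` against (C). Necessity only; nothing about sufficiency. [cite: CheskidovShvydkoy2010, Lemma 3.2 (proof, (8))] -/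
theorem cascade_necessities :
    ∃ (c κ : ℝ), 0 < c ∧ 0 < κ ∧ ∀ (ν T : ℝ), 0 < ν → 0 < T →
      ∀ (u : ℝ → EuclideanSpace ℝ (Fin 3) → EuclideanSpace ℝ (Fin 3)) (p : ℝ → EuclideanSpace ℝ (Fin 3) → ℝ),
      IsMaximalSmoothSolution ν 0 u p T → IsLerayHopfOn T ν 0 (u 0) u →
      (∀ b : ℝ, 0 < b → b < c →
        ∃ (q : ℕ → ℕ) (t : ℕ → ℝ), StrictMono q ∧ StrictMono t ∧ (∀ n, 0 < t n ∧ t n < T) ∧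
          (∀ n, IsSaturatedLevel b ν (u (t n)) (q n)) ∧ Tendsto t atTop (𝓝 T) ∧ Tendsto q atTop atTop) ∧
      ∀ t₀ ∈ Ioo 0 T,
        (∀ t₁ ∈ Ico t₀ T, ∀ B : Finset ℤ,
          -∑ j ∈ B, (∫ τ in t₀..t₁, ∫ x, ⟪blockFn j (u τ) x, blockFn j (convect (u τ) (u τ)) x⟫) ≤
            8 * (eLpNorm (u 0) 2 volume).toReal ^ 2) ∧
        (∃ᶠ q : ℕ in atTop, ∃ (N : ℕ) (t₁ : ℝ), t₁ ∈ Ioo t₀ T ∧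
          κ * ν ^ 3 ≤ (eLpNorm (u 0) 2 volume).toReal * ((2 : ℝ) ^ q * Real.sqrt ((2 : ℝ) ^ q)) *
            -∑ k ∈ Finset.range N, (∫ τ in t₀..t₁,
              ∫ x, ⟪blockFn ((q + k : ℕ) : ℤ) (u τ) x, blockFn ((q + k : ℕ) : ℤ) (convect (u τ) (u τ)) x⟫)) ∧
        (∀ η : ℝ, 0 ≤ η → 2 * Real.sqrt 2 * η < 1 →
          ∃ᶠ q : ℕ in atTop, ∃ (N : ℕ) (t₁ : ℝ), t₁ ∈ Ioo t₀ T ∧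
            η * -∑ k ∈ Finset.range (N + 1), (∫ τ in t₀..t₁,
                ∫ x, ⟪blockFn ((q + k : ℕ) : ℤ) (u τ) x, blockFn ((q + k : ℕ) : ℤ) (convect (u τ) (u τ)) x⟫) <
              -∑ k ∈ Finset.range N, (∫ τ in t₀..t₁,
                ∫ x, ⟪blockFn ((q + 1 + k : ℕ) : ℤ) (u τ) x,
                  blockFn ((q + 1 + k : ℕ) : ℤ) (convect (u τ) (u τ)) x⟫)) := by
  obtain ⟨c, hc, HR⟩ := SaturationHorizon.exists_saturation_chain_tendsto
  obtain ⟨κ, hκ, HF⟩ := ForwardFluxFloor.forward_flux_floor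
  refine ⟨c, κ, hc, hκ, fun ν T hν hT u p hmax hLH => ⟨HR ν T hν hT u p hmax hLH, fun t₀ ht₀ => ⟨?_, ?_, ?_⟩⟩⟩
  · exact fun t₁ ht₁ B => band_flux_le hν hT hmax hLH ht₀.1 ht₁.1 ht₁.2 B
  · exact HF ν T hν hT u p hmax hLH t₀ ht₀
  · exact fun η hη0 hη => FluxPassOnFloor.pass_on_floor hν hT hmax hLH ht₀ hη0 hη

end Summit.NavierStokesRegularity.FluidComputer.CascadeNecessities

end
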